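import Mathlib
import HarnessLib
import Literature.Analysis.Convex.LPPrimalDualPathFollowing
import Literature.Analysis.Convex.GeneralizedLogarithms

/-!
# Primal–dual solutions of a standard-form LP and the primal Newton barrier method
# (Antoniou–Lu 2007, §12.2.1 Theorems 12.1–12.2, (12.3)–(12.7); §12.4 (12.26)–(12.38);
# Problems 12.9, 12.11, 12.12)

Topic `Literature/Analysis/Convex`; namespace `Literature.Analysis.Convex.PrimalNewtonBarrierLP`.
Source: A. Antoniou, W.-S. Lu, *Practical Optimization: Algorithms and Engineering Applications*,
Springer (2007) [AL07] (bib `AntoniouLu2007`; held copy `book:antoniou2007-practical-optimization`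
read — the held text is in 3000-character chunks, so the locators below are SECTION / EQUATION /
THEOREM / PROBLEM numbers, never page numbers), Ch. 12 "Linear programming Part II: interior-point
methods", §12.2.1 "Primal-dual solutions" and §12.4 "Primal Newton barrier method" (PNB method).
Everything below is PROVED (no `sorry`, no named facts); the only definitions are the barrier
objective `barrierObj` (12.26a) and its gradient `barrierGrad` (12.27a).

Setting [AL07 §12.2]: primal `minimize cᵀx s.t. Ax = b, x ≥ 0` (12.1), `A ∈ ℝ^{p×n}`; dual
`maximize bᵀλ s.t. Aᵀλ + μ = c, μ ≥ 0` (12.2); a PRIMAL–DUAL SOLUTION is `{x*, λ*, μ*}` with (12.3)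
`Aᵀλ* + μ* = c, Ax* = b, xᵢ*μᵢ* = 0, x* ≥ 0, μ* ≥ 0`.  Vectors are `n → ℝ` / `p → ℝ`, the book's
`λ` is written `lam` (reserved word), `X = diag{x}` is `Matrix.diagonal x` and `X⁻¹e`, `X⁻²d` are
written componentwise (`τ / x i`, `τ * d i / x i ^ 2`).  Imports: the gap identity (12.6)/(12.10)
`cᵀx − bᵀλ = μᵀx` and the central-path value `nτ` are the tree's
`LPPrimalDualPathFollowing.gap_eq_compl` / `gap_on_central_path`, and the orthant barrier
`−Σ ln xᵢ` with its line derivatives is `GeneralizedLogarithm.orthantBarrier` (both imported, not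
restated).

## §12.2.1 (Theorems 12.1, 12.2 and (12.4)–(12.7))

* `value_eq_of_kkt` — (12.5): (12.3) gives `cᵀx* = bᵀλ*` ("`f(x*) = h(λ*)`").
* `kkt_primal_optimal`, `kkt_dual_optimal` — the two sentences after (12.3): a triple satisfying
  (12.3) has `x*` optimal for the primal and `{λ*, μ*}` optimal for the dual (the computation (12.4)
  `λᵀb ≤ λᵀb + μᵀx = cᵀx`, i.e. weak duality, is `gap_eq_compl` plus `μᵀx ≥ 0`).
* `objective_excess_bounds` — (12.7): `0 ≤ cᵀx − cᵀx* ≤ δ(x, λ)` for feasible `x`, `{λ, μ}`.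
* Theorem 12.2(a), proof: for `{λ, μ}` STRICTLY dual feasible, `x` primal feasible and `x*` a primal
  solution, `μᵀx* = cᵀx* − λᵀb ≤ cᵀx − λᵀb = μᵀx` (`compl_le_of_primal_optimal`) and hence
  `xᵢ* ≤ μᵀx/μᵢ` (`primal_solution_le`: "`x*` is bounded"); Theorem 12.2(b) ("can be proved in a
  similar manner"): `μᵢ* ≤ μᵀx/xᵢ` for a strictly primal-feasible `x` (`compl_le_of_dual_optimal`,
  `dual_solution_le`).

## §12.4 (the PNB method)

* `barrierObj` — (12.26a) `f_τ(x) = cᵀx − τ Σᵢ ln xᵢ`; `barrierGrad` — (12.27a) `∇f_τ(x) = c − τX⁻¹e`.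
* `barrierObj_eq_orthantBarrier` — `f_τ = cᵀx + τF`, `F = −Σ ln xᵢ` the tree's orthant barrier
  (`GeneralizedLogarithm.orthantBarrier`, BV Example 11.5 / JV §32.5), whose line derivatives
  (`hasDerivAt_orthantBarrier_line`, `…_line_deriv`, `hessForm_pos`) are REUSED, not restated:
  `barrierObj_line`, `hasDerivAt_barrierObj_line`, `barrierObj_lineDeriv_zero` — along `x + αd`
  (with `x + αd > 0`): `d f_τ(x + αd)/dα = cᵀd − τ Σ dᵢ/(xᵢ + αdᵢ)`, which at `α = 0` is `∇f_τ(x)ᵀd`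
  (12.27a); `hasDerivAt_barrierObj_lineDeriv`, `barrierObj_lineSecondDeriv_pos` — §12.4.4:
  `d²f_τ(x_k + αd_k)/dα² = τ Σ (dᵢ/(xᵢ + αdᵢ))² > 0` for `d_k ≠ 0` (the displayed formula prints
  `dᵢ` for `dᵢ²`; this is (12.27b) `∇²f_τ = τX⁻²` along the line), so "`f_τ(x_k + αd_k)` is
  strictly convex on `[0, ᾱ_k]`".
* §12.4.3, (12.28) = Problem 12.11(a): if `x_k*` minimises `f_{τ_k}` and `x_{k+1}*` minimises
  `f_{τ_{k+1}}` over the same set, `0 ≤ τ_{k+1} < τ_k`, then `cᵀx_{k+1}* ≤ cᵀx_k*` — proved for an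
  arbitrary objective `f − τu` on an arbitrary set (`barrierTerm_mono_of_minimizers`: also
  `u(x_{k+1}*) ≤ u(x_k*)`; `objective_anti_of_minimizers`) and specialised to (12.26)
  (`lp_objective_anti_of_barrier_minimizers`).
* §12.4.3, (12.30)–(12.32) (= Problem 12.12(b)): the KKT condition `Aᵀλ + τX⁻¹e = c` of the
  subproblem at `x > 0` puts `{x, λ, μ = τX⁻¹e}` on the central path (12.9): `μ > 0`, `Aᵀλ + μ = c`,
  `Xμ = τe` (`central_of_barrier_kkt`), and conversely (`barrier_kkt_of_central`).
* §12.4.2 "Since `f_τ(x)` is convex, `x_τ*` … is a global minimizer", made quantitative WITHOUT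
  compactness: a strictly feasible KKT point minimises `f_τ` over all strictly feasible points
  (`barrierObj_le_of_kkt`, via `ln t ≤ t − 1`) and is the UNIQUE minimiser (`barrierObj_lt_of_kkt`,
  via `ln t < t − 1` for `t ≠ 1`) — so "a unique solution of the subproblem" (§12.4.1) as far as
  uniqueness goes; Problem 12.9 (analytic center, the case `c = 0`, `τ = 1`): the KKT condition
  `X⁻¹e = Aᵀλ` characterises the maximiser of `Σ ln xᵢ` on `{Ax = b, x > 0}`
  (`logSum_le_of_analyticCenter_kkt`, `logSum_lt_of_analyticCenter_kkt`).
* §12.4.4, (12.35)–(12.38) (= Problems 12.11(b), 12.12(c)–(d)): `step_feasible` ((12.35) keeps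
  `Ax = b`); `newton_kkt_iff_closedForm` — the KKT equation (12.37a)
  `τX⁻²d + c − τX⁻¹e = Aᵀλ` is equivalent, componentwise, to (12.38a)
  `d = x + (1/τ)X²(Aᵀλ − c)` (= (P12.3a) `x − (1/τ)X²μ`, `μ = c − Aᵀλ`, `closedForm_eq_P12_3`);
  `closedForm_apply` (the vector form with `X² = diagonal x * diagonal x`); `newton_feasible_iff` —
  given (12.38a), (12.37b) `Ad = 0` holds iff `λ` solves (12.38b) `AX²Aᵀλ = A(X²c − τx)`;
  `posDef_barrierNormalMatrix` — "the `p × p` symmetric positive-definite system in Eq. (12.38b)" (for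
  `x` with nonzero entries and `A` of full row rank); `newton_slope_eq`, `newton_descent` — the
  Newton direction is a descent direction for `f_τ`: `∇f_τ(x)ᵀd = −τ‖X⁻¹d‖² < 0` for `d ≠ 0`;
  `closedForm_eq_zero_iff` — `d = 0` exactly when `x` already satisfies (12.30), i.e. is the point
  `x(τ)` of the central path.

Not formalised: the existence / compactness argument of §12.4.2 (Theorem 4 of the book's [2]), the
limits (12.29), (12.34) and the `O(τ)` / `O(τ^{1/2})` estimates of §12.4.3, the step bound (12.39)
(it is `PrimalAffineScaling.stepPos_iff_lt_minRatio` / `stepPos_ratio_rule` with `0.99` in place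
of `γ`), Algorithm 12.2 and Example 12.3 as computations, Problem 12.15 (P12.4) and Theorem 12.1's
existence statement (LP strong duality is `LinearProgrammingDuality.duality_nonneg_eq`, Schrijver's
form, not restated here).

Published results only (Lean placement rule): every public declaration carries its
`[cite: AntoniouLu2007, §… (eq.)]` locator.
-/

namespace Literature.Analysis.Convex.PrimalNewtonBarrierLP

open Matrix Finset GeneralizedLogarithm

/-! ### §12.4.3, (12.28): monotonicity of the objective along a decreasing barrier parameter -/

section Abstract

variable {X : Type*} {S : Set X} (f u : X → ℝ) {τ τ' : ℝ} {x x' : X}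

/-- Problem 12.11(a), the mechanism behind (12.28), for an arbitrary objective `f − τu` on an
arbitrary set `S`: if `x` minimises `f − τu` and `x'` minimises `f − τ'u` on `S` with `τ' < τ`, then
the "barrier utility" does not increase: `u(x') ≤ u(x)` (add the two optimality inequalities
displayed before (12.28)). [cite: AntoniouLu2007, §12.4.3 (12.28), Problem 12.11(a)] -/
theorem barrierTerm_mono_of_minimizers (hτ : τ' < τ) (hxS : x ∈ S) (hx'S : x' ∈ S)
    (hx : ∀ z ∈ S, f x - τ * u x ≤ f z - τ * u z)
    (hx' : ∀ z ∈ S, f x' - τ' * u x' ≤ f z - τ' * u z) : u x' ≤ u x := by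
  have h1 := hx x' hx'S
  have h2 := hx' x hxS
  by_contra hle
  have hlt : u x < u x' := lt_of_not_ge hle
  have h3 := mul_lt_mul_of_neg_right hτ (show u x - u x' < 0 by linarith)
  rw [mul_sub, mul_sub] at h3
  linarith

/-- (12.28): with `0 ≤ τ' < τ` as above, `f(x') ≤ f(x)` — "the objective function of the original
LP problem is a monotonically decreasing function" along the sequence of subproblem minimisers.
[cite: AntoniouLu2007, §12.4.3 (12.28), Problem 12.11(a)] -/
theorem objective_anti_of_minimizers (hτ' : 0 ≤ τ') (hτ : τ' < τ) (hxS : x ∈ S) (hx'S : x' ∈ S)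
    (hx : ∀ z ∈ S, f x - τ * u x ≤ f z - τ * u z)
    (hx' : ∀ z ∈ S, f x' - τ' * u x' ≤ f z - τ' * u z) : f x' ≤ f x := by
  have hu := barrierTerm_mono_of_minimizers f u hτ hxS hx'S hx hx'
  have h2 := hx' x hxS
  have h3 : τ' * u x' ≤ τ' * u x := mul_le_mul_of_nonneg_left hu hτ'
  linarith

end Abstract

variable {n p : Type*} [Fintype n] [Fintype p]

/-! ### §12.2.1 Primal–dual solutions -/

/-- (12.5): a triple satisfying (12.3) has `cᵀx* = [(μ*)ᵀ + (λ*)ᵀA]x* = (λ*)ᵀAx* = (λ*)ᵀb`,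
i.e. `f(x*) = h(λ*)`. [cite: AntoniouLu2007, §12.2.1 (12.3), (12.5)] -/
theorem value_eq_of_kkt {A : Matrix p n ℝ} {b lam : p → ℝ} {c x μ : n → ℝ} (hP : A *ᵥ x = b)
    (hD : Aᵀ *ᵥ lam + μ = c) (hC : ∀ i, x i * μ i = 0) : c ⬝ᵥ x = b ⬝ᵥ lam := by
  have h := LPPrimalDualPathFollowing.gap_on_central_path hP hD hC
  rwa [mul_zero, sub_eq_zero] at h

/-- After (12.3): `x*` from a triple satisfying (12.3) solves the primal (12.1) — for every feasible
`x`, `cᵀx* ≤ cᵀx` (by (12.4)/(12.5): `cᵀx − bᵀλ* = (μ*)ᵀx ≥ 0` and `cᵀx* = bᵀλ*`).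
[cite: AntoniouLu2007, §12.2.1 (12.3)-(12.5), Theorem 12.1] -/
theorem kkt_primal_optimal {A : Matrix p n ℝ} {b lam : p → ℝ} {c xs μ : n → ℝ} (hP : A *ᵥ xs = b)
    (hD : Aᵀ *ᵥ lam + μ = c) (hC : ∀ i, xs i * μ i = 0) (hμ : ∀ i, 0 ≤ μ i)
    {x : n → ℝ} (hx : A *ᵥ x = b) (hx0 : ∀ i, 0 ≤ x i) : c ⬝ᵥ xs ≤ c ⬝ᵥ x := by
  have h1 := value_eq_of_kkt hP hD hC
  have h2 := LPPrimalDualPathFollowing.gap_eq_compl hx hD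
  have h3 : 0 ≤ μ ⬝ᵥ x := Finset.sum_nonneg fun i _ => mul_nonneg (hμ i) (hx0 i)
  linarith

/-- After (12.3): `{λ*, μ*}` from a triple satisfying (12.3) (with `x* ≥ 0`) solves the dual
(12.2) — for every dual-feasible `{λ, μ}`, `bᵀλ ≤ bᵀλ*` ("a set of vectors `{λ*, μ*}` satisfying
Eq. (12.3) is a maximizer for the dual problem"). [cite: AntoniouLu2007, §12.2.1 (12.3)-(12.5), Theorem 12.1] -/
theorem kkt_dual_optimal {A : Matrix p n ℝ} {b lams : p → ℝ} {c xs μs : n → ℝ} (hP : A *ᵥ xs = b)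
    (hxs0 : ∀ i, 0 ≤ xs i) (hD : Aᵀ *ᵥ lams + μs = c) (hC : ∀ i, xs i * μs i = 0)
    {lam : p → ℝ} {μ : n → ℝ} (hDf : Aᵀ *ᵥ lam + μ = c) (hμ : ∀ i, 0 ≤ μ i) :
    b ⬝ᵥ lam ≤ b ⬝ᵥ lams := by
  have h1 := value_eq_of_kkt hP hD hC
  have h2 := LPPrimalDualPathFollowing.gap_eq_compl hP hDf
  have h3 : 0 ≤ μ ⬝ᵥ xs := Finset.sum_nonneg fun i _ => mul_nonneg (hμ i) (hxs0 i)
  linarith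

/-- (12.7): for feasible `x` and `{λ, μ}` and a primal–dual solution `{x*, λ*, μ*}`,
`cᵀx ≥ cᵀx* = bᵀλ* ≥ bᵀλ`, hence `0 ≤ cᵀx − cᵀx* ≤ δ(x, λ) = cᵀx − bᵀλ` ("the duality gap can
serve as a bound on the closeness of `f(x)` to `f(x*)`").
[cite: AntoniouLu2007, §12.2.1 (12.6)-(12.7)] -/
theorem objective_excess_bounds {A : Matrix p n ℝ} {b lam lams : p → ℝ} {c x xs μ μs : n → ℝ}
    (hx : A *ᵥ x = b) (hx0 : ∀ i, 0 ≤ x i) (hDf : Aᵀ *ᵥ lam + μ = c) (hμ : ∀ i, 0 ≤ μ i)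
    (hP : A *ᵥ xs = b) (hxs0 : ∀ i, 0 ≤ xs i) (hD : Aᵀ *ᵥ lams + μs = c) (hμs : ∀ i, 0 ≤ μs i)
    (hC : ∀ i, xs i * μs i = 0) :
    0 ≤ c ⬝ᵥ x - c ⬝ᵥ xs ∧ c ⬝ᵥ x - c ⬝ᵥ xs ≤ c ⬝ᵥ x - b ⬝ᵥ lam := by
  have h1 := kkt_primal_optimal hP hD hC hμs hx hx0
  have h2 := kkt_dual_optimal hP hxs0 hD hC hDf hμ
  have h3 := value_eq_of_kkt hP hD hC
  constructor <;> linarith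

/-- Theorem 12.2(a), proof: for `{λ, μ}` dual feasible, `x` primal feasible and `x*` feasible with
`cᵀx* ≤ cᵀx`, `μᵀx* = cᵀx* − λᵀb ≤ cᵀx − λᵀb = μᵀx`.
[cite: AntoniouLu2007, §12.2.1 Theorem 12.2(a) (proof)] -/
theorem compl_le_of_primal_optimal {A : Matrix p n ℝ} {b lam : p → ℝ} {c x xs μ : n → ℝ}
    (hx : A *ᵥ x = b) (hP : A *ᵥ xs = b) (hD : Aᵀ *ᵥ lam + μ = c) (hopt : c ⬝ᵥ xs ≤ c ⬝ᵥ x) :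
    μ ⬝ᵥ xs ≤ μ ⬝ᵥ x := by
  have h1 := LPPrimalDualPathFollowing.gap_eq_compl hP hD
  have h2 := LPPrimalDualPathFollowing.gap_eq_compl hx hD
  linarith

/-- **Theorem 12.2(a)** (solutions of the primal are bounded if the dual is strictly feasible),
quantitatively: with `μ > 0`, `x* ≥ 0`, `μᵢ*xᵢ* ≤ μᵀx* ≤ μᵀx`, hence `xᵢ* ≤ μᵀx/μᵢ`
(`≤ max_i (1/μᵢ)·μᵀx`). [cite: AntoniouLu2007, §12.2.1 Theorem 12.2(a)] -/
theorem primal_solution_le {A : Matrix p n ℝ} {b lam : p → ℝ} {c x xs μ : n → ℝ}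
    (hx : A *ᵥ x = b) (hP : A *ᵥ xs = b) (hD : Aᵀ *ᵥ lam + μ = c) (hopt : c ⬝ᵥ xs ≤ c ⬝ᵥ x)
    (hxs0 : ∀ i, 0 ≤ xs i) (hμ : ∀ i, 0 < μ i) (i : n) : xs i ≤ μ ⬝ᵥ x / μ i := by
  rw [le_div_iff₀ (hμ i), mul_comm]
  calc μ i * xs i ≤ μ ⬝ᵥ xs :=
        Finset.single_le_sum (f := fun j => μ j * xs j)
          (fun j _ => mul_nonneg (hμ j).le (hxs0 j)) (mem_univ i)
    _ ≤ μ ⬝ᵥ x := compl_le_of_primal_optimal hx hP hD hopt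

/-- Theorem 12.2(b), proof ("in a similar manner"): for `x` primal feasible, `{λ*, μ*}` and
`{λ, μ}` dual feasible with `bᵀλ ≤ bᵀλ*`, `(μ*)ᵀx = cᵀx − bᵀλ* ≤ cᵀx − bᵀλ = μᵀx`.
[cite: AntoniouLu2007, §12.2.1 Theorem 12.2(b) (proof)] -/
theorem compl_le_of_dual_optimal {A : Matrix p n ℝ} {b lam lams : p → ℝ} {c x μ μs : n → ℝ}
    (hx : A *ᵥ x = b) (hD : Aᵀ *ᵥ lams + μs = c) (hDf : Aᵀ *ᵥ lam + μ = c)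
    (hopt : b ⬝ᵥ lam ≤ b ⬝ᵥ lams) : μs ⬝ᵥ x ≤ μ ⬝ᵥ x := by
  have h1 := LPPrimalDualPathFollowing.gap_eq_compl hx hD
  have h2 := LPPrimalDualPathFollowing.gap_eq_compl hx hDf
  linarith

/-- **Theorem 12.2(b)** (solutions of the dual are bounded if the primal is strictly feasible),
quantitatively: with `x > 0` and `μ* ≥ 0`, `μᵢ* ≤ μᵀx/xᵢ`.
[cite: AntoniouLu2007, §12.2.1 Theorem 12.2(b)] -/
theorem dual_solution_le {A : Matrix p n ℝ} {b lam lams : p → ℝ} {c x μ μs : n → ℝ}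
    (hx : A *ᵥ x = b) (hD : Aᵀ *ᵥ lams + μs = c) (hDf : Aᵀ *ᵥ lam + μ = c)
    (hopt : b ⬝ᵥ lam ≤ b ⬝ᵥ lams) (hμs0 : ∀ i, 0 ≤ μs i) (hx0 : ∀ i, 0 < x i) (i : n) :
    μs i ≤ μ ⬝ᵥ x / x i := by
  rw [le_div_iff₀ (hx0 i)]
  calc μs i * x i ≤ μs ⬝ᵥ x :=
        Finset.single_le_sum (f := fun j => μs j * x j)
          (fun j _ => mul_nonneg (hμs0 j) (hx0 j).le) (mem_univ i)
    _ ≤ μ ⬝ᵥ x := compl_le_of_dual_optimal hx hD hDf hopt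

/-! ### §12.4.1–§12.4.2 The barrier subproblem (12.26), its gradient and Hessian (12.27) -/

/-- (12.26a): the logarithmic-barrier objective `f_τ(x) = cᵀx − τ Σᵢ ln xᵢ` of the subproblem
(12.26) (`minimize f_τ(x) subject to Ax = b`), `τ > 0` the barrier parameter.
[cite: AntoniouLu2007, §12.4.1 (12.26a)] -/
noncomputable def barrierObj (c : n → ℝ) (τ : ℝ) (x : n → ℝ) : ℝ :=
  c ⬝ᵥ x - τ * ∑ i, Real.log (x i)

omit [Fintype n] in
/-- (12.27a): `∇f_τ(x) = c − τX⁻¹e`, componentwise `cᵢ − τ/xᵢ`.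
[cite: AntoniouLu2007, §12.4.2 (12.27a)] -/
noncomputable def barrierGrad (c : n → ℝ) (τ : ℝ) (x : n → ℝ) : n → ℝ := fun i => c i - τ / x i

/-- `f_τ = cᵀx + τF(x)` with `F(x) = −Σ ln xᵢ` the logarithmic barrier of the positive orthant
(the tree's `GeneralizedLogarithm.orthantBarrier`). [cite: AntoniouLu2007, §12.4.1 (12.26a)] -/
theorem barrierObj_eq_orthantBarrier (c : n → ℝ) (τ : ℝ) (x : n → ℝ) :
    barrierObj c τ x = c ⬝ᵥ x + τ * orthantBarrier x := by
  simp only [barrierObj, orthantBarrier, mul_neg, sub_eq_add_neg]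

/-- `f_τ` along the line `x + αd`: `f_τ(x + αd) = cᵀx + α cᵀd − τ Σ ln(xᵢ + αdᵢ)`.
[cite: AntoniouLu2007, §12.4.1 (12.26a); §12.4.4 (line search on f_τ(x_k + αd_k))] -/
theorem barrierObj_line (c x d : n → ℝ) (τ a : ℝ) :
    barrierObj c τ (x + a • d) = c ⬝ᵥ x + a * (c ⬝ᵥ d) - τ * ∑ i, Real.log (x i + a * d i) := by
  simp [barrierObj, dotProduct_add, dotProduct_smul, smul_eq_mul]

/-- (12.27a) along a line: for `x + αd > 0`,
`d f_τ(x + αd)/dα = cᵀd − τ Σᵢ dᵢ/(xᵢ + αdᵢ)` (`= ∇f_τ(x + αd)ᵀd`) — the linear part plus `τ`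
times the tree's `GeneralizedLogarithm.hasDerivAt_orthantBarrier_line`.
[cite: AntoniouLu2007, §12.4.2 (12.27a); §12.4.4] -/
theorem hasDerivAt_barrierObj_line (c : n → ℝ) (τ : ℝ) {x d : n → ℝ} {a : ℝ}
    (hpos : ∀ i, 0 < x i + a * d i) :
    HasDerivAt (fun t => barrierObj c τ (x + t • d))
      (c ⬝ᵥ d - τ * ∑ i, d i / (x i + a * d i)) a := by
  have hB := (hasDerivAt_orthantBarrier_line hpos).const_mul τ
  have hL : HasDerivAt (fun t => c ⬝ᵥ x + t * (c ⬝ᵥ d)) (1 * (c ⬝ᵥ d)) a :=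
    ((hasDerivAt_id a).mul_const _).const_add _
  refine ((hL.add hB).congr_deriv (by ring)).congr_of_eventuallyEq
    (Filter.Eventually.of_forall fun t => ?_)
  simp only [barrierObj_line, orthantBarrier, Pi.add_apply, Pi.smul_apply, smul_eq_mul, mul_neg,
    sub_eq_add_neg]

/-- At `α = 0` the line derivative is `∇f_τ(x)ᵀd` with `∇f_τ(x) = c − τX⁻¹e` (12.27a).
[cite: AntoniouLu2007, §12.4.2 (12.27a)] -/
theorem barrierObj_lineDeriv_zero (c : n → ℝ) (τ : ℝ) (x d : n → ℝ) :
    c ⬝ᵥ d - τ * ∑ i, d i / (x i + 0 * d i) = barrierGrad c τ x ⬝ᵥ d := by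
  simp only [zero_mul, add_zero, barrierGrad, dotProduct, sub_mul, Finset.sum_sub_distrib,
    Finset.mul_sum]
  congr 1
  exact Finset.sum_congr rfl fun i _ => by ring

/-- (12.27b) along a line (§12.4.4): `d²f_τ(x + αd)/dα² = τ Σᵢ (dᵢ/(xᵢ + αdᵢ))²`
(`= dᵀ(τX⁻²)d` at the point `x + αd`), for `x + αd > 0` — `τ` times the tree's
`GeneralizedLogarithm.hasDerivAt_orthantBarrier_line_deriv`.
[cite: AntoniouLu2007, §12.4.2 (12.27b); §12.4.4 (d²f_τ(x_k + αd_k)/dα²)] -/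
theorem hasDerivAt_barrierObj_lineDeriv (c : n → ℝ) (τ : ℝ) {x d : n → ℝ} {a : ℝ}
    (hpos : ∀ i, 0 < x i + a * d i) :
    HasDerivAt (fun t => c ⬝ᵥ d - τ * ∑ i, d i / (x i + t * d i))
      (τ * ∑ i, (d i / (x i + a * d i)) ^ 2) a := by
  have h := ((hasDerivAt_orthantBarrier_line_deriv hpos).const_mul τ).const_add (c ⬝ᵥ d)
  refine h.congr_of_eventuallyEq (Filter.Eventually.of_forall fun t => ?_)
  simp only [mul_neg, sub_eq_add_neg]

/-- §12.4.4: "`d²f_τ(x_k + αd_k)/dα² = τ Σ dᵢ²/(xᵢ + αdᵢ)² > 0`", for `τ > 0`, `x + αd > 0` and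
`d ≠ 0` (the sum is the tree's `GeneralizedLogarithm.hessForm (x + αd) d > 0`) — so
`f_τ(x_k + αd_k)` is strictly convex on `[0, ᾱ_k]` and has a unique minimum there.
[cite: AntoniouLu2007, §12.4.4 (strict convexity of f_τ(x_k + αd_k))] -/
theorem barrierObj_lineSecondDeriv_pos {τ : ℝ} (hτ : 0 < τ) {x d : n → ℝ} {a : ℝ}
    (hpos : ∀ i, 0 < x i + a * d i) (hd : d ≠ 0) :
    0 < τ * ∑ i, (d i / (x i + a * d i)) ^ 2 := by
  have h := hessForm_pos (x := x + a • d) (h := d) (fun i => by simpa using hpos i) hd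
  refine mul_pos hτ ?_
  simpa [hessForm] using h

omit [Fintype p] in
/-- (12.28) for the subproblem (12.26): if `x` minimises `f_τ` and `x'` minimises `f_{τ'}` over the
strictly feasible set `{z : Az = b, z > 0}`, with `0 ≤ τ' < τ`, then `cᵀx' ≤ cᵀx` (and
`Σ ln x'ᵢ ≤ Σ ln xᵢ`). [cite: AntoniouLu2007, §12.4.3 (12.28), Problem 12.11(a)] -/
theorem lp_objective_anti_of_barrier_minimizers {A : Matrix p n ℝ} {b : p → ℝ}
    {c x x' : n → ℝ} {τ τ' : ℝ} (hτ' : 0 ≤ τ') (hτ : τ' < τ)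
    (hx : A *ᵥ x = b ∧ ∀ i, 0 < x i) (hx' : A *ᵥ x' = b ∧ ∀ i, 0 < x' i)
    (hmin : ∀ z, A *ᵥ z = b → (∀ i, 0 < z i) → barrierObj c τ x ≤ barrierObj c τ z)
    (hmin' : ∀ z, A *ᵥ z = b → (∀ i, 0 < z i) → barrierObj c τ' x' ≤ barrierObj c τ' z) :
    c ⬝ᵥ x' ≤ c ⬝ᵥ x ∧ ∑ i, Real.log (x' i) ≤ ∑ i, Real.log (x i) := by
  let S : Set (n → ℝ) := {z | A *ᵥ z = b ∧ ∀ i, 0 < z i}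
  have h1 : ∀ z ∈ S, (fun z => c ⬝ᵥ z) x - τ * (fun z => ∑ i, Real.log (z i)) x ≤
      (fun z => c ⬝ᵥ z) z - τ * (fun z => ∑ i, Real.log (z i)) z :=
    fun z hz => hmin z hz.1 hz.2
  have h2 : ∀ z ∈ S, (fun z => c ⬝ᵥ z) x' - τ' * (fun z => ∑ i, Real.log (z i)) x' ≤
      (fun z => c ⬝ᵥ z) z - τ' * (fun z => ∑ i, Real.log (z i)) z :=
    fun z hz => hmin' z hz.1 hz.2
  have hxS : x ∈ S := hx
  have hx'S : x' ∈ S := hx'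
  exact ⟨objective_anti_of_minimizers (S := S) (fun z : n → ℝ => c ⬝ᵥ z)
      (fun z : n → ℝ => ∑ i, Real.log (z i)) hτ' hτ hxS hx'S h1 h2,
    barrierTerm_mono_of_minimizers (S := S) (fun z : n → ℝ => c ⬝ᵥ z)
      (fun z : n → ℝ => ∑ i, Real.log (z i)) hτ hxS hx'S h1 h2⟩

/-! ### §12.4.3, (12.30)–(12.32): KKT points of the subproblem lie on the central path -/

omit [Fintype n] in
/-- (12.30)–(12.32) (= Problem 12.12(b)): if `x > 0` satisfies the KKT condition
`Aᵀλ + τX⁻¹e = c` (12.30) of the subproblem (12.26) with `τ > 0`, then with `μ = τX⁻¹e` (12.31)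
one has `μ > 0`, `Aᵀλ + μ = c` (12.32b) and `Xμ = τe` (12.32c): together with `Ax = b` (12.32a),
`{x, λ, μ}` is the point of the central path (12.9) with parameter `τ`.
[cite: AntoniouLu2007, §12.4.3 (12.30)-(12.32); Problem 12.12(b)] -/
theorem central_of_barrier_kkt {A : Matrix p n ℝ} {lam : p → ℝ} {c x : n → ℝ} {τ : ℝ}
    (hx : ∀ i, 0 < x i) (hτ : 0 < τ) (hkkt : ∀ i, (Aᵀ *ᵥ lam) i + τ / x i = c i) :
    (∀ i, 0 < τ / x i) ∧ (Aᵀ *ᵥ lam + fun i => τ / x i) = c ∧ ∀ i, x i * (τ / x i) = τ := by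
  refine ⟨fun i => div_pos hτ (hx i), funext fun i => hkkt i, fun i => ?_⟩
  rw [mul_div_assoc', mul_div_cancel_left₀ τ (hx i).ne']

omit [Fintype n] in
/-- Conversely, a central-path point (12.9) (`Aᵀλ + μ = c`, `Xμ = τe`, `x` with nonzero entries)
satisfies the barrier KKT condition (12.30) `Aᵀλ + τX⁻¹e = c` (its `μ` IS `τX⁻¹e`).
[cite: AntoniouLu2007, §12.4.3 (12.30)-(12.32), (12.9)] -/
theorem barrier_kkt_of_central {A : Matrix p n ℝ} {lam : p → ℝ} {c x μ : n → ℝ} {τ : ℝ}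
    (hx : ∀ i, x i ≠ 0) (hD : Aᵀ *ᵥ lam + μ = c) (hC : ∀ i, x i * μ i = τ) :
    ∀ i, (Aᵀ *ᵥ lam) i + τ / x i = c i := by
  intro i
  have hμ : τ / x i = μ i := by
    rw [← hC i, mul_comm, mul_div_assoc, div_self (hx i), mul_one]
  rw [hμ, ← hD]
  rfl

/-! ### §12.4.2 / Problem 12.9: the KKT point is the unique global minimiser of the subproblem -/

/-- The linear part vanishes: under (12.30) and `Ax = Ay`, `Σᵢ (cᵢ − τ/xᵢ)(yᵢ − xᵢ) =
(Aᵀλ)ᵀ(y − x) = λᵀA(y − x) = 0`. [cite: AntoniouLu2007, §12.4.3 (12.30); §12.4.2] -/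
theorem barrierGrad_dotProduct_sub_eq_zero {A : Matrix p n ℝ} {lam : p → ℝ} {c x y : n → ℝ}
    {τ : ℝ} (hA : A *ᵥ x = A *ᵥ y) (hkkt : ∀ i, (Aᵀ *ᵥ lam) i + τ / x i = c i) :
    ∑ i, (c i - τ / x i) * (y i - x i) = 0 := by
  have h1 : ∀ i, c i - τ / x i = (Aᵀ *ᵥ lam) i := fun i => by linarith [hkkt i]
  simp_rw [h1]
  have h : (Aᵀ *ᵥ lam) ⬝ᵥ (y - x) = 0 := by
    rw [mulVec_transpose, ← dotProduct_mulVec, mulVec_sub, hA, sub_self, dotProduct_zero]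
  simpa [dotProduct] using h

/-- §12.4.2 ("Since `f_τ(x)` is convex, `x_τ*` … is a global minimizer of the problem in
Eq. (12.26)"), quantitatively and without the compactness argument: if `x > 0`, `Ax = b`,
satisfies the KKT condition (12.30) with `τ ≥ 0`, then `f_τ(x) ≤ f_τ(y)` for every `y > 0` with
`Ay = b` (from `ln t ≤ t − 1` at `t = yᵢ/xᵢ`). [cite: AntoniouLu2007, §12.4.2; §12.4.3 (12.30); Problem 12.9(b)] -/
theorem barrierObj_le_of_kkt {A : Matrix p n ℝ} {b lam : p → ℝ} {c x y : n → ℝ} {τ : ℝ}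
    (hx : ∀ i, 0 < x i) (hy : ∀ i, 0 < y i) (hAx : A *ᵥ x = b) (hAy : A *ᵥ y = b) (hτ : 0 ≤ τ)
    (hkkt : ∀ i, (Aᵀ *ᵥ lam) i + τ / x i = c i) : barrierObj c τ x ≤ barrierObj c τ y := by
  have hlin := barrierGrad_dotProduct_sub_eq_zero (hAx.trans hAy.symm) hkkt
  have e1 : c ⬝ᵥ y - c ⬝ᵥ x = τ * ∑ i, (y i / x i - 1) := by
    have : c ⬝ᵥ y - c ⬝ᵥ x =
        ∑ i, (c i - τ / x i) * (y i - x i) + τ * ∑ i, (y i / x i - 1) := by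
      simp only [dotProduct, Finset.mul_sum, ← Finset.sum_add_distrib, ← Finset.sum_sub_distrib]
      exact Finset.sum_congr rfl fun i _ => by have := (hx i).ne'; field_simp; ring
    rw [this, hlin, zero_add]
  have hlog : ∀ i, Real.log (y i) - Real.log (x i) ≤ y i / x i - 1 := fun i => by
    rw [← Real.log_div (hy i).ne' (hx i).ne']
    exact Real.log_le_sub_one_of_pos (div_pos (hy i) (hx i))
  have e2 : τ * ∑ i, (Real.log (y i) - Real.log (x i)) ≤ τ * ∑ i, (y i / x i - 1) :=
    mul_le_mul_of_nonneg_left (Finset.sum_le_sum fun i _ => hlog i) hτ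
  rw [Finset.sum_sub_distrib, mul_sub] at e2
  unfold barrierObj
  linarith

/-- Uniqueness (§12.4.1 "a unique solution of the subproblem in Eq. (12.26) exists", as far as
uniqueness goes): under the hypotheses of `barrierObj_le_of_kkt` with `τ > 0`, any other strictly
feasible `y ≠ x` has `f_τ(x) < f_τ(y)` (`ln t < t − 1` for `t ≠ 1`).
[cite: AntoniouLu2007, §12.4.1-§12.4.2 (uniqueness of the minimizer of (12.26))] -/
theorem barrierObj_lt_of_kkt {A : Matrix p n ℝ} {b lam : p → ℝ} {c x y : n → ℝ} {τ : ℝ}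
    (hx : ∀ i, 0 < x i) (hy : ∀ i, 0 < y i) (hAx : A *ᵥ x = b) (hAy : A *ᵥ y = b) (hτ : 0 < τ)
    (hkkt : ∀ i, (Aᵀ *ᵥ lam) i + τ / x i = c i) (hne : y ≠ x) :
    barrierObj c τ x < barrierObj c τ y := by
  have hlin := barrierGrad_dotProduct_sub_eq_zero (hAx.trans hAy.symm) hkkt
  have e1 : c ⬝ᵥ y - c ⬝ᵥ x = τ * ∑ i, (y i / x i - 1) := by
    have : c ⬝ᵥ y - c ⬝ᵥ x =
        ∑ i, (c i - τ / x i) * (y i - x i) + τ * ∑ i, (y i / x i - 1) := by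
      simp only [dotProduct, Finset.mul_sum, ← Finset.sum_add_distrib, ← Finset.sum_sub_distrib]
      exact Finset.sum_congr rfl fun i _ => by have := (hx i).ne'; field_simp; ring
    rw [this, hlin, zero_add]
  have hlog : ∀ i, Real.log (y i) - Real.log (x i) ≤ y i / x i - 1 := fun i => by
    rw [← Real.log_div (hy i).ne' (hx i).ne']
    exact Real.log_le_sub_one_of_pos (div_pos (hy i) (hx i))
  obtain ⟨j, hj⟩ := Function.ne_iff.1 hne
  have hlogj : Real.log (y j) - Real.log (x j) < y j / x j - 1 := by
    rw [← Real.log_div (hy j).ne' (hx j).ne']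
    exact Real.log_lt_sub_one_of_pos (div_pos (hy j) (hx j))
      (fun h => hj ((div_eq_one_iff_eq (hx j).ne').1 h))
  have hlt : ∑ i, (Real.log (y i) - Real.log (x i)) < ∑ i, (y i / x i - 1) :=
    Finset.sum_lt_sum (fun i _ => hlog i) ⟨j, mem_univ j, hlogj⟩
  have e2 : τ * ∑ i, (Real.log (y i) - Real.log (x i)) < τ * ∑ i, (y i / x i - 1) :=
    mul_lt_mul_of_pos_left hlt hτ
  rw [Finset.sum_sub_distrib, mul_sub] at e2
  unfold barrierObj
  linarith

/-- **Problem 12.9** (analytic center): if `x > 0`, `Ax = b`, satisfies the KKT condition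
`X⁻¹e = Aᵀλ` of (P12.1) (`minimize −Σ ln xᵢ subject to Ax = b`), then `x` maximises `Σ ln xᵢ`
over `{Ay = b, y > 0}` — the KKT conditions are sufficient (Problem 12.9(b)); this is the case
`c = 0`, `τ = 1` of the subproblem (12.26). [cite: AntoniouLu2007, §12.4 Problem 12.9 (P12.1)] -/
theorem logSum_le_of_analyticCenter_kkt {A : Matrix p n ℝ} {b lam : p → ℝ} {x y : n → ℝ}
    (hx : ∀ i, 0 < x i) (hy : ∀ i, 0 < y i) (hAx : A *ᵥ x = b) (hAy : A *ᵥ y = b)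
    (hkkt : ∀ i, 1 / x i = (Aᵀ *ᵥ lam) i) :
    ∑ i, Real.log (y i) ≤ ∑ i, Real.log (x i) := by
  have h := barrierObj_le_of_kkt (c := 0) (τ := 1) (lam := -lam) hx hy hAx hAy zero_le_one
    (fun i => by rw [mulVec_neg, Pi.neg_apply, ← hkkt i, Pi.zero_apply]; ring)
  simp only [barrierObj, zero_dotProduct, one_mul, zero_sub, neg_le_neg_iff] at h
  exact h

/-- Problem 12.9, uniqueness of the analytic center: with the KKT condition at `x`, every other
feasible `y > 0`, `y ≠ x`, has `Σ ln yᵢ < Σ ln xᵢ`. [cite: AntoniouLu2007, §12.4 Problem 12.9 (P12.1)] -/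
theorem logSum_lt_of_analyticCenter_kkt {A : Matrix p n ℝ} {b lam : p → ℝ} {x y : n → ℝ}
    (hx : ∀ i, 0 < x i) (hy : ∀ i, 0 < y i) (hAx : A *ᵥ x = b) (hAy : A *ᵥ y = b)
    (hkkt : ∀ i, 1 / x i = (Aᵀ *ᵥ lam) i) (hne : y ≠ x) :
    ∑ i, Real.log (y i) < ∑ i, Real.log (x i) := by
  have h := barrierObj_lt_of_kkt (c := 0) (τ := 1) (lam := -lam) hx hy hAx hAy zero_lt_one
    (fun i => by rw [mulVec_neg, Pi.neg_apply, ← hkkt i, Pi.zero_apply]; ring) hne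
  simp only [barrierObj, zero_dotProduct, one_mul, zero_sub, neg_lt_neg_iff] at h
  exact h

/-! ### §12.4.4, (12.35)–(12.38): the Newton direction of the PNB method -/

omit [Fintype p] in
/-- (12.35): a direction with `Ad_k = 0` keeps the equality constraints,
`Ax_{k+1} = Ax_k + α_kAd_k = b`. [cite: AntoniouLu2007, §12.4.4 (12.35)] -/
theorem step_feasible {A : Matrix p n ℝ} {b : p → ℝ} {x d : n → ℝ} (hx : A *ᵥ x = b)
    (hd : A *ᵥ d = 0) (α : ℝ) : A *ᵥ (x + α • d) = b := by
  rw [mulVec_add, mulVec_smul, hd, smul_zero, add_zero, hx]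

omit [Fintype n] in
/-- **(12.37a) ⟺ (12.38a)** (Problem 12.11(b)), componentwise, for `x` with nonzero entries and
`τ ≠ 0`: the KKT equation `τX⁻²d + c − τX⁻¹e = Aᵀλ` of the quadratic model (12.36) holds in
coordinate `i` iff `dᵢ = xᵢ + xᵢ²((Aᵀλ)ᵢ − cᵢ)/τ`, i.e. `d = x + (1/τ)X²(Aᵀλ − c)`.
[cite: AntoniouLu2007, §12.4.4 (12.36)-(12.38a); Problem 12.11(b); Problem 12.12(c)-(d) (P12.2b)] -/
theorem newton_kkt_iff_closedForm {A : Matrix p n ℝ} {lam : p → ℝ} {c x d : n → ℝ} {τ : ℝ}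
    (hx : ∀ i, x i ≠ 0) (hτ : τ ≠ 0) (i : n) :
    τ * d i / x i ^ 2 + c i - τ / x i = (Aᵀ *ᵥ lam) i ↔
      d i = x i + x i ^ 2 * ((Aᵀ *ᵥ lam) i - c i) / τ := by
  have hxi := hx i
  have hid : τ * d i / x i ^ 2 + c i - τ / x i - (Aᵀ *ᵥ lam) i =
      τ / x i ^ 2 * (d i - (x i + x i ^ 2 * ((Aᵀ *ᵥ lam) i - c i) / τ)) := by
    field_simp
    ring
  have hne : τ / x i ^ 2 ≠ 0 := div_ne_zero hτ (pow_ne_zero 2 hxi)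
  rw [← sub_eq_zero, hid, mul_eq_zero, or_iff_right hne, sub_eq_zero]

omit [Fintype n] in
/-- (12.38a) = (P12.3a)–(P12.3b): `x + (1/τ)X²(Aᵀλ − c) = x − (1/τ)X²μ` with `μ = c − Aᵀλ`.
[cite: AntoniouLu2007, §12.4.4 (12.38a); Problem 12.12(d) (P12.3a)-(P12.3b)] -/
theorem closedForm_eq_P12_3 (a c x : n → ℝ) (τ : ℝ) (i : n) :
    x i + x i ^ 2 * (a i - c i) / τ = x i - x i ^ 2 * (c - a) i / τ := by
  simp only [Pi.sub_apply]
  ring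

/-- The vector form of (12.38a): with `X² = diagonal x * diagonal x`,
`(x + τ⁻¹X²(a − c))ᵢ = xᵢ + xᵢ²(aᵢ − cᵢ)/τ`. [cite: AntoniouLu2007, §12.4.4 (12.38a)] -/
theorem closedForm_apply [DecidableEq n] (x c a : n → ℝ) (τ : ℝ) (i : n) :
    (x + τ⁻¹ • ((diagonal x * diagonal x) *ᵥ (a - c))) i = x i + x i ^ 2 * (a i - c i) / τ := by
  simp [diagonal_mul_diagonal, mulVec_diagonal]
  ring

/-- **(12.38b)**: for the direction `d = x + (1/τ)X²(Aᵀλ − c)` of (12.38a) (`τ ≠ 0`), the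
remaining KKT equation (12.37b) `Ad = 0` holds iff `λ` solves the `p × p` system
`AX²Aᵀλ = A(X²c − τx)`. [cite: AntoniouLu2007, §12.4.4 (12.37b), (12.38b); Problem 12.11(b); Problem 12.12(d) (P12.3c)] -/
theorem newton_feasible_iff [DecidableEq n] {A : Matrix p n ℝ} {lam : p → ℝ} {c x d : n → ℝ}
    {τ : ℝ} (hτ : τ ≠ 0) (hd : d = x + τ⁻¹ • ((diagonal x * diagonal x) *ᵥ (Aᵀ *ᵥ lam - c))) :
    A *ᵥ d = 0 ↔
      (A * (diagonal x * diagonal x) * Aᵀ) *ᵥ lam =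
        A *ᵥ ((diagonal x * diagonal x) *ᵥ c - τ • x) := by
  rw [diagonal_mul_diagonal] at hd ⊢
  set X2 : Matrix n n ℝ := diagonal fun i => x i * x i with hX2
  have h1 : A *ᵥ d = A *ᵥ x + τ⁻¹ • ((A * X2 * Aᵀ) *ᵥ lam - A *ᵥ (X2 *ᵥ c)) := by
    rw [hd, mulVec_add, mulVec_smul, mulVec_sub, mulVec_sub, ← mulVec_mulVec, ← mulVec_mulVec]
  have h2 : A *ᵥ (X2 *ᵥ c - τ • x) = A *ᵥ (X2 *ᵥ c) - τ • (A *ᵥ x) := by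
    rw [mulVec_sub, mulVec_smul]
  rw [h1, h2]
  constructor
  · intro h
    funext j
    have hj := congrFun h j
    simp only [Pi.add_apply, Pi.smul_apply, Pi.sub_apply, Pi.zero_apply, smul_eq_mul] at hj ⊢
    have hj' := congrArg (fun t => τ * t) hj
    simp only [mul_add, ← mul_assoc, mul_inv_cancel₀ hτ, one_mul, mul_zero] at hj'
    linarith
  · intro h
    funext j
    have hj := congrFun h j
    simp only [Pi.add_apply, Pi.smul_apply, Pi.sub_apply, Pi.zero_apply, smul_eq_mul] at hj ⊢
    rw [hj]
    field_simp
    ring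

/-- "the `p × p` symmetric positive-definite system in Eq. (12.38b)": `AX²Aᵀ ≻ 0` for `x` with
nonzero entries and `A` of full row rank (`Aᵀ` injective) — `vᵀAX²Aᵀv = Σᵢ (xᵢ(Aᵀv)ᵢ)² > 0` for
`v ≠ 0`. [cite: AntoniouLu2007, §12.4.4 (12.38b)] -/
theorem posDef_barrierNormalMatrix [DecidableEq n] {A : Matrix p n ℝ} {x : n → ℝ} (hx : ∀ i, x i ≠ 0)
    (hA : Function.Injective Aᵀ.mulVec) : (A * (diagonal x * diagonal x) * Aᵀ).PosDef := by
  rw [diagonal_mul_diagonal]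
  refine PosDef.of_dotProduct_mulVec_pos ?_ fun v hv => ?_
  · simp only [IsHermitian, conjTranspose_eq_transpose_of_trivial, transpose_mul,
      transpose_transpose, diagonal_transpose, Matrix.mul_assoc]
  · have hq : star v ⬝ᵥ (A * (diagonal fun i => x i * x i) * Aᵀ) *ᵥ v =
        ∑ i, (x i * (Aᵀ *ᵥ v) i) ^ 2 := by
      rw [star_trivial, ← mulVec_mulVec, ← mulVec_mulVec, dotProduct_mulVec, ← mulVec_transpose]
      simp only [dotProduct, mulVec_diagonal]
      exact Finset.sum_congr rfl fun i _ => by ring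
    rw [hq]
    have hne : Aᵀ *ᵥ v ≠ 0 := fun h0 => hv (hA (by rw [h0, mulVec_zero]))
    obtain ⟨j, hj⟩ := Function.ne_iff.1 hne
    refine Finset.sum_pos' (fun i _ => sq_nonneg _) ⟨j, mem_univ j, ?_⟩
    have hxj := hx j
    have hj' : (Aᵀ *ᵥ v) j ≠ 0 := hj
    positivity

/-- The Newton direction is a descent direction for `f_τ`: if `d` satisfies the KKT equation
(12.37a) and `Ad = 0` (12.37b), then `∇f_τ(x)ᵀd = (Aᵀλ − τX⁻²d)ᵀd = −τ Σ (dᵢ/xᵢ)²`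
("To find a descent direction, …" (12.36)). [cite: AntoniouLu2007, §12.4.4 (12.36)-(12.37)] -/
theorem newton_slope_eq {A : Matrix p n ℝ} {lam : p → ℝ} {c x d : n → ℝ} {τ : ℝ}
    (hx : ∀ i, x i ≠ 0) (hkkt : ∀ i, τ * d i / x i ^ 2 + c i - τ / x i = (Aᵀ *ᵥ lam) i)
    (hAd : A *ᵥ d = 0) : barrierGrad c τ x ⬝ᵥ d = -(τ * ∑ i, (d i / x i) ^ 2) := by
  have h0 : (Aᵀ *ᵥ lam) ⬝ᵥ d = 0 := by
    rw [mulVec_transpose, ← dotProduct_mulVec, hAd, dotProduct_zero]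
  have h1 : barrierGrad c τ x ⬝ᵥ d = (Aᵀ *ᵥ lam) ⬝ᵥ d - τ * ∑ i, (d i / x i) ^ 2 := by
    simp only [barrierGrad, dotProduct, Finset.mul_sum, ← Finset.sum_sub_distrib]
    refine Finset.sum_congr rfl fun i _ => ?_
    have hxi := hx i
    rw [← hkkt i]
    field_simp
    ring
  rw [h1, h0, zero_sub]

/-- Hence, for `τ > 0` and `d ≠ 0`, `∇f_τ(x)ᵀd < 0`: the solution of (12.36)/(12.37) is a descent
direction of the barrier objective at `x_k`. [cite: AntoniouLu2007, §12.4.4 (12.36)-(12.37)] -/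
theorem newton_descent {A : Matrix p n ℝ} {lam : p → ℝ} {c x d : n → ℝ} {τ : ℝ} (hτ : 0 < τ)
    (hx : ∀ i, x i ≠ 0) (hkkt : ∀ i, τ * d i / x i ^ 2 + c i - τ / x i = (Aᵀ *ᵥ lam) i)
    (hAd : A *ᵥ d = 0) (hd : d ≠ 0) : barrierGrad c τ x ⬝ᵥ d < 0 := by
  rw [newton_slope_eq hx hkkt hAd, neg_lt_zero]
  obtain ⟨j, hj⟩ := Function.ne_iff.1 hd
  refine mul_pos hτ (Finset.sum_pos' (fun i _ => sq_nonneg _) ⟨j, mem_univ j, ?_⟩)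
  have hxj := hx j
  have hdj : d j ≠ 0 := hj
  positivity

omit [Fintype n] in
/-- The direction (12.38a) vanishes in coordinate `i` iff `(Aᵀλ)ᵢ + τ/xᵢ = cᵢ`; so `d_k = 0`
exactly when `x_k` (with this `λ`) already satisfies the KKT condition (12.30) of the subproblem,
i.e. is the central-path point `x(τ)` (`central_of_barrier_kkt`).
[cite: AntoniouLu2007, §12.4.4 (12.38a); §12.4.3 (12.30)] -/
theorem closedForm_eq_zero_iff {a c x : n → ℝ} {τ : ℝ} (hx : ∀ i, x i ≠ 0) (hτ : τ ≠ 0) (i : n) :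
    x i + x i ^ 2 * (a i - c i) / τ = 0 ↔ a i + τ / x i = c i := by
  have hxi := hx i
  have hid : x i + x i ^ 2 * (a i - c i) / τ = x i ^ 2 / τ * (a i + τ / x i - c i) := by
    field_simp
    ring
  rw [hid, mul_eq_zero, or_iff_right (div_ne_zero (pow_ne_zero 2 hxi) hτ), sub_eq_zero]

end Literature.Analysis.Convex.PrimalNewtonBarrierLP
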